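import Summits.ResolutionOfSingularities.ResolutionOfSingularities.Theorems.FrobeniusLadderFRationalResolutionRegularLocusOpenImmersion
import Literature.AlgebraicGeometry.Resolution.AffineBlowup
import HarnessLib

/-!
# Crux `FrobeniusLadder.FRationalResolution` (stmt-ResolutionOfSingularities-15317), line `redirect`,
# stub `stub_diagonalizableQuotientResolution` — **points of an affine blow-up off the centre are regular when
# the base is** (brick for P7-c3 of memo MEMO-15317-leafhand2-g8 §7: in the scheme round only the points over the
# blown-up point need the chart analysis)

Generic. `Bl_I(Spec R) → Spec R` is an isomorphism over `⨆_{a ∈ I} D(a)` (`affineBlowup.isIso_morphismRestrict_iSup`),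
so through the open immersion `π⁻¹(⨆ D(a)) ↪ Spec R` regular points correspond
(`preimage_regularLocus_of_isOpenImmersion`):

* `mem_regularLocus_of_apply_mem` — if `π y ∈ D(a)` for some `a ∈ I` and `π y` is a regular point of `Spec R`,
  then `y` is a regular point of `Bl_I(Spec R)`;
* `preimage_iSup_le_regularLocus` — if `Spec R` is regular off `V(I)` then `π⁻¹(⨆ D(a)) ⊆ Reg Bl_I(Spec R)`.

Honest label: scheme plumbing toward ONE leaf stub (no stub, crux or summit closed). No definitions, no named
facts, no sorry. [cite: StacksProject, Tag 02OS] [cite: GortzWedhorn2020, Prop. 13.91]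
-/

noncomputable section

-- single-problem summit: the doubled namespace component is forced
set_option linter.dupNamespace false

open CategoryTheory AlgebraicGeometry TopologicalSpace
open Literature.AlgebraicGeometry.Resolution

namespace Summit.ResolutionOfSingularities.ResolutionOfSingularities.Theorems.FRationalResolution.BlowupRegularOffCentre

/-- **Off the centre, regular points of the base give regular points of the blow-up.**
[cite: StacksProject, Tag 02OS] -/
theorem mem_regularLocus_of_apply_mem {R : Type} [CommRing R] (I : Ideal R)
    (hopen : IsOpen (Scheme.regularLocus (affineBlowup I)))
    (hopenR : IsOpen (Scheme.regularLocus (Spec (.of R)))) (y : affineBlowup I)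
    (hy : affineBlowup.π I y ∈ (⨆ a : I, (PrimeSpectrum.basicOpen (a : R) : (Spec (.of R)).Opens)))
    (hreg : affineBlowup.π I y ∈ Scheme.regularLocus (Spec (.of R))) :
    y ∈ Scheme.regularLocus (affineBlowup I) := by
  set π := affineBlowup.π I with hπdef
  set W : (Spec (.of R)).Opens := ⨆ a : I, (PrimeSpectrum.basicOpen (a : R) : (Spec (.of R)).Opens)
    with hWdef
  have hyW : y ∈ π ⁻¹ᵁ W := hy
  -- the open immersion `π ⁻¹ W ↪ Spec R`
  let j : ((π ⁻¹ᵁ W : (affineBlowup I).Opens) : Scheme.{0}) ⟶ Spec (.of R) := (π ⁻¹ᵁ W).ι ≫ π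
  have hj : j = (π ∣_ W) ≫ W.ι := (morphismRestrict_ι π W).symm
  haveI : IsIso (π ∣_ W) := affineBlowup.isIso_morphismRestrict_iSup (I := I)
  haveI : IsOpenImmersion j := by rw [hj]; infer_instance
  have hpre := preimage_regularLocus_of_isOpenImmersion (π ⁻¹ᵁ W) j hopen hopenR
  have h1 : (⟨y, hyW⟩ : (π ⁻¹ᵁ W : (affineBlowup I).Opens)) ∈
      j ⁻¹ᵁ ⟨Scheme.regularLocus (Spec (.of R)), hopenR⟩ := by
    show j.base ⟨y, hyW⟩ ∈ Scheme.regularLocus (Spec (.of R))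
    have : j.base ⟨y, hyW⟩ = π y := by
      show (π.base) ((π ⁻¹ᵁ W).ι.base ⟨y, hyW⟩) = π y
      rw [Scheme.Opens.ι_apply]
    rw [this]; exact hreg
  rw [hpre] at h1
  exact h1

/-- **If `Spec R` is regular off `V(I)` then `π⁻¹(⨆_{a ∈ I} D(a))` consists of regular points of
`Bl_I(Spec R)`.** [cite: StacksProject, Tag 02OS] -/
theorem preimage_iSup_le_regularLocus {R : Type} [CommRing R] (I : Ideal R)
    (hopen : IsOpen (Scheme.regularLocus (affineBlowup I)))
    (hopenR : IsOpen (Scheme.regularLocus (Spec (.of R))))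
    (hRegI : ∀ P : Spec (.of R), ¬ I ≤ P.asIdeal → P ∈ Scheme.regularLocus (Spec (.of R))) :
    ∀ y : affineBlowup I,
      affineBlowup.π I y ∈ (⨆ a : I, (PrimeSpectrum.basicOpen (a : R) : (Spec (.of R)).Opens)) →
        y ∈ Scheme.regularLocus (affineBlowup I) := by
  intro y hy
  refine mem_regularLocus_of_apply_mem I hopen hopenR y hy (hRegI _ ?_)
  obtain ⟨⟨a, haI⟩, ha⟩ := Opens.mem_iSup.mp hy
  exact SetLike.not_le_iff_exists.mpr ⟨a, haI, (PrimeSpectrum.mem_basicOpen _ _).mp ha⟩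

end Summit.ResolutionOfSingularities.ResolutionOfSingularities.Theorems.FRationalResolution.BlowupRegularOffCentre

end
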